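import Summits.HodgeConjecture.HodgeConjecture.Theorems.Ring2DeformQbarAbelianFibres
import Literature.AlgebraicGeometry.LaurentSchroer2023.ParaAbelianGroupLaw
import Literature.AlgebraicGeometry.HodgeTheory.SpreadingOutQbarFamilyProofs
import Literature.AlgebraicGeometry.Motives.AbelianVarietyProjective
import Mathlib.AlgebraicGeometry.AlgClosed.Basic
import HarnessLib

/-!
# Ring 2 · route `deform`, XVI-d — the residual node R′ = `QbarFibreDescent` of part XVI-c PROVED modulo one named
# print fact (Laurent–Schröer's para-abelian descent, field case): the binder `hE` of part XVI is now discharged to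
# FIVE NAMED PRINT FACTS and no `@[conjecture]` node of this axis

HONEST FRAMING: research route conditional on HC_CM; not a corollary; Q11.4-sentence-2 already refuted in dim ≥ 3.

WHAT THIS PART DOES (and does not). Part XVI-c left ONE residual of `hE = QbarHodgeFamilies` that was not a named
print fact: R′ = `QbarFibreDescent` — an abelian complex fibre `𝒳_t ≅ A'.X` over a point `t` of the `ℚ̄`-locus of a
`ℚ̄`-family `f₀ : 𝒳₀ ⟶ S₀` is the complexification of an abelian variety over `ℚ^al ⊂ ℂ` of dimension `dim A'`
("theorem in print, OPEN in Lean on these carriers"). Here R′ is PROVED in the kernel from ONE cited fact: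
* §A SCHEME PLUMBING, kernel-proved [folklore]: (A1) `eq_specMap_comp_pointOfClosedPoint` — over an algebraically
  closed `K`, an `L`-valued point `Spec L → X` over `Spec σ` (`σ : K →+* L`) centred at a CLOSED point factors as
  `Spec L → Spec K → X` through the `K`-rational point of that closed point (Nullstellensatz `κ(x) = K`, Mathlib
  `residueFieldIsoBase` / `pointOfClosedPoint`; the two maps `κ(x) → L` agree because both restrict to `σ` on `K`);
  (A2) `exists_ratPoint_over_of_isClosed` — every point of the `ℚ̄`-locus (`qbarLocus`, part XVI) lies OVER a
  `ℚ̄`-rational point `w` of `S₀` (`t ≫ π = Spec σ ≫ w`); (A3) `exists_ratPoint_fibreIso_of_isClosed` — hence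
  `𝒳_t ≅ (𝒳₀)_w ⊗_{ℚ̄,σ} ℂ` (pasting of fibre squares, the argument of the tree's
  `QbarFibreAnchors.fiberOver_baseChangeHom_iso_of_over`, Hartshorne II.3 Thm. 3.3); (A4) `dim_eq_of_iso_X` —
  isomorphic abelian varieties have the same dimension (homeomorphic underlying spaces); (A5)
  `exists_abelianVariety_over_intermediate` — a model over an intermediate field `k → M → L`, compatibly with base
  change to `L` (transitivity of pull-back, Mathlib `Over.pullbackComp`).
* §B THE DESCENT, kernel-proved modulo the fact: `qbarFibreDescent_of_paraAbelianDescent :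
  LaurentSchroer2023.groupLaw_of_isParaAbelian_of_point ℚ̄ → QbarFibreDescent`. The `ℚ̄`-fibre `P = (𝒳₀)_w` is
  PARA-ABELIAN (`A'.X ≅ 𝒳_t ≅ P ⊗_σ ℂ`, `LaurentSchroer2023.IsParaAbelian.of_iso` with the `ℚ̄`-algebra structure
  `σ` on `ℂ`), so — `ℚ̄` being algebraically closed — it is the `ℚ̄`-scheme of an abelian variety `A₁` (the
  Literature corollary `LaurentSchroer2023.exists_abelianVariety_of_isParaAbelian` of THE FACT: a para-abelian
  scheme is non-empty and locally of finite type by fpqc descent, so has a rational point by the Nullstellensatz,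
  and Prop. 4.3 applies); (A5) along the corestriction `σ' : ℚ̄ →+* ℚ^al` of `σ` (every `σ(a)` is algebraic over `ℚ`)
  gives `A₀/ℚ^al` with `A₀ ⊗ ℂ ≅ A₁ ⊗_σ ℂ = P ⊗_σ ℂ ≅ 𝒳_t`, and `dim A₀ = dim (A₀ ⊗ ℂ) = dim A'`
  (`AbelianVariety.dim_baseChange`, (A4)).
* §C `hE` FROM FIVE NAMED PRINT FACTS — Voisin's `ℚ̄`-spread (`hVo`), Deligne's partie fixe (`hD`), Deligne 1982
  Thm. 2.11 (`hDel`), Catanese's abelian fibres (`hCat`), Laurent–Schröer's para-abelian descent (`hLS`) — and the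
  three headline rows of XVI-b/XVI-c re-based on them: `HC_AV ↔ HC_QbarAV ∧ Q`, `HC_AV ↔ HC_CM ∧ L(𝔇) ∧ Q`, and THE
  ITEM `CMToAbelian ↔ ModCM (L(𝔇) ∧ Q)` (stmt-HodgeConjecture-16267), now modulo [`hJ`; five named print facts] and
  NO `@[conjecture]` node of this axis other than the GENUINELY OPEN ones they name (`Q = QbarSpreading`,
  `HC_QbarAV`, `HC_CM`, `L(𝔇)`).

THE FACT (D-0014; `Literature/AlgebraicGeometry/LaurentSchroer2023/ParaAbelianGroupLaw.lean`, the cell's literature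
seat): Laurent–Schröer, *Para-abelian varieties and Albanese maps*, §4 — *"Let us call an algebraic space `P` over
some field `k` a para-abelian variety if there is a field extension `k ⊂ k'` such that the base-change `P' = P ⊗_k k'`
admits the structure of an abelian variety"* (`LaurentSchroer2023.IsParaAbelian`); Prop. 4.3 — *"For each
`e ∈ P(S)`, there is a unique group law `μ : P ×_S P → P` that turns `P → S` into a family of abelian varieties, with
`e : S → P` as the zero section"* (proof: *"this settles the assertion if `R = k` is a field"*), existence half over
`S = Spec k` = `LaurentSchroer2023.groupLaw_of_isParaAbelian_of_point k`. It is consumed BY NAME as the binder `hLS`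
(at `k = ℚ̄ = AlgebraicClosure ℚ`), never asserted — and, since 2026-08-21, PROVED at that `k` (REVISION 3 below).

REVISION 3 (2026-08-21; DOCSTRING-ONLY — every statement and proof below is byte-identical to rev. 2, p205942). THE
FACT is now a Literature THEOREM in exactly the generality consumed here:
`LaurentSchroer2023.groupLaw_of_isParaAbelian_of_point_holds (k) [Field k] [IsAlgClosed k]`
(`Literature/AlgebraicGeometry/LaurentSchroer2023/ParaAbelianGroupLawHolds.lean`, seat ring2-b01, p299204) — Prop. 4.3
for `S = Spec k`, `k` algebraically closed, proved NOT by the printed fpqc descent of the group law but by spreading the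
group law of `A'` out to a finitely generated `k`-subalgebra of `L` (EGA IV₃ 8.8.2; `Limits/SubalgebraGroupSpread`,
p297387) and specialising at a `k`-point (Nullstellensatz) — the "equivalently" clause of part XVI-c's docstring of R′;
the case of a general ground field stays a named fact, undischarged and unconsumed on this axis. Hence §B applied to
that theorem gives R′ OUTRIGHT, `qbarFibreDescent_holds : QbarFibreDescent`, and the rows of §C lose the binder `hLS`:
part XVI-e `Ring2DeformQbarFibreDescentHolds` (ring2-b01, p300410; the names `…_of_fourPrintFacts`, term reuse of this
file). THIS file is unchanged — its theorems remain the `hLS`-parametrised forms XVI-e instantiates — and its honest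
column (1)–(2) is DATED accordingly. Count once: the discharge and XVI-e are ring2-b01's.
[cite: LaurentSchroer2023, §4 Prop. 4.3 (case S = Spec k, k algebraically closed)] [cite: EGAIV3, Thm. 8.8.2]

HONEST COLUMN. (1) PROVED here: §A–§C, kernel-checked, every hypothesis BY NAME; R′ is no longer a node but a theorem
modulo `hLS` — and since 2026-08-21 a theorem OUTRIGHT (`qbarFibreDescent_holds`, XVI-e; REVISION 3). (2) IN PRINT,
hypotheses in Lean: the five facts at rev. 2; FOUR since 2026-08-21 (`hVo`, `hD`, `hDel`, `hCat`) — `hLS` is the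
Literature theorem `LaurentSchroer2023.groupLaw_of_isParaAbelian_of_point_holds (AlgebraicClosure ℚ)`; in Lean each
remaining fact can only fail by a carrier mismatch (the dictionary of each is in its Literature file). (3) UNCHANGED
and OPEN: Q (`QbarSpreading`, the KIND-2 reading of part XVI), `HC_QbarAV`, `HC_CM`, `L(𝔇)`;
stmt-HodgeConjecture-16267 stays OPEN; nothing here is a case of HC and no converse `R′ ⟸ hE` is claimed. (4) New
mathematics: none — the value is that the `ℚ̄`-point axis of the deformation route is now EXACT modulo named print
facts only: `HC_AV ↔ HC_QbarAV ∧ Q` with both sides' auxiliaries cited theorems.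
-/

set_option linter.dupNamespace false
-- Mathlib's pull-back / `Over` API is stated through `abbrev`s over `limit` and `Over.mk`; as in Mathlib's own
-- algebraic-geometry files (and the tree's `SpreadingOutQbarFamilyProofs`, `QbarFibreAnchors`) we let `rw`/unification
-- see through them.
set_option backward.isDefEq.respectTransparency false

namespace Summit.HodgeConjecture.HodgeConjecture.Ring2.Deform

open CategoryTheory CategoryTheory.Limits AlgebraicGeometry IsLocalRing
open Literature.AlgebraicGeometry Literature.AlgebraicGeometry.Motives
open Literature.AlgebraicGeometry.HodgeTheory
open Summit.HodgeConjecture.HodgeConjecture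
open Summit.HodgeConjecture.HodgeConjecture.Theses
open Summit.HodgeConjecture.HodgeConjecture.Theses.RankFourFaces (CMAbelianHodge CMToAbelian)
open Summit.HodgeConjecture.HodgeConjecture.Theses.PadicSemiregularLift (HodgeAbelianVarieties)
open Summit.HodgeConjecture.HodgeConjecture.Ring2.AbelianAll (ClosesWithCM ExactWithCM ModCM PivotAV)

universe u

/-! ## §A Scheme plumbing: points of the `ℚ̄`-locus lie over rational points; the fibre there is a complexification -/

/-- **(A1) A point over `Spec σ` centred at a closed point factors through the rational point of that closed point.**
For `K` algebraically closed, `X → Spec K` locally of finite type, `σ : K →+* L` and `P : Spec L → X` with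
`P ≫ (X → Spec K) = Spec σ` whose image is a closed point `x`: `P = Spec σ ≫ x_K`, where `x_K : Spec K → X` is the
`K`-rational point at `x` (Mathlib `pointOfClosedPoint`; `κ(x) = K` by the Nullstellensatz, Mathlib
`residueFieldIsoBase`). Proof: `P` factors through `Spec κ(x)` (Mathlib
`Scheme.descResidueField_stalkClosedPointTo_fromSpecResidueField`) and the induced `κ(x) → L`, precomposed with
`K ≅ κ(x)`, is `σ` (test after `Spec`, where both sides become `P ≫ (X → Spec K)`).
[cite: Hartshorne1977, Ch. II Ex. 2.7 and Ex. 3.14] -/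
theorem eq_specMap_comp_pointOfClosedPoint {K L : Type u} [Field K] [IsAlgClosed K] [Field L] (σ : K →+* L)
    {X : Scheme.{u}} (f : X ⟶ Spec (.of K)) [LocallyOfFiniteType f] (P : Spec (.of L) ⟶ X)
    (hP : P ≫ f = Spec.map (CommRingCat.ofHom σ)) (hx : IsClosed ({P (closedPoint L)} : Set X)) :
    P = Spec.map (CommRingCat.ofHom σ) ≫ pointOfClosedPoint f (P (closedPoint L)) hx := by
  have hPfac : Spec.map (X.descResidueField (Scheme.stalkClosedPointTo P)) ≫
      X.fromSpecResidueField (P (closedPoint L)) = P :=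
    Scheme.descResidueField_stalkClosedPointTo_fromSpecResidueField L X P
  have key : (residueFieldIsoBase f (P (closedPoint L)) hx).inv ≫
      X.descResidueField (Scheme.stalkClosedPointTo P) = CommRingCat.ofHom σ := by
    apply Spec.map_injective
    rw [Spec.map_comp, SpecMap_residueFieldIsoBase_inv, ← Category.assoc, hPfac, hP]
  calc P = Spec.map (X.descResidueField (Scheme.stalkClosedPointTo P)) ≫
        X.fromSpecResidueField (P (closedPoint L)) := hPfac.symm
    _ = Spec.map ((residueFieldIsoBase f (P (closedPoint L)) hx).hom ≫ CommRingCat.ofHom σ) ≫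
        X.fromSpecResidueField (P (closedPoint L)) := by rw [← key, Iso.hom_inv_id_assoc]
    _ = Spec.map (CommRingCat.ofHom σ) ≫ pointOfClosedPoint f (P (closedPoint L)) hx := by
        rw [Spec.map_comp, Category.assoc]; rfl

/-- **(A2) A point of `S₀ ⊗_σ L` over a closed point of `S₀` lies over a `K`-rational point.** For `K`
algebraically closed, `S₀ → Spec K` locally of finite type, `σ : K →+* L` and an `L`-point `t` of `S₀ ⊗_σ L` whose
image `x ∈ S₀` under the projection `π` is closed, there is `w ∈ S₀(K)` with `t ≫ π = Spec σ ≫ w`: `w` is the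
rational point at `x` and the factorisation is (A1) applied to `t ≫ π`, a point over `Spec σ` by the base-change
square. With `K = ℚ̄`, `L = ℂ` the hypothesis reads `t ∈ qbarLocus σ S₀` (part XVI). [cite: Hartshorne1977, Ch. II Ex. 3.14] -/
theorem exists_ratPoint_over_of_isClosed {K L : Type u} [Field K] [IsAlgClosed K] [Field L] (σ : K →+* L)
    (S₀ : SchemeOver K) [LocallyOfFiniteType S₀.hom] (t : AlgPoints ((baseChangeHom σ).obj S₀) L)
    (ht : IsClosed ({(t.left ≫ baseChangeHomFst σ S₀) (closedPoint L)} : Set S₀.left)) :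
    ∃ w : AlgPoints S₀ K, t.left ≫ baseChangeHomFst σ S₀ = Spec.map (CommRingCat.ofHom σ) ≫ w.left := by
  have hsq : baseChangeHomFst σ S₀ ≫ S₀.hom =
      ((baseChangeHom σ).obj S₀).hom ≫ Spec.map (CommRingCat.ofHom σ) := pullback.condition
  have hP : (t.left ≫ baseChangeHomFst σ S₀) ≫ S₀.hom = Spec.map (CommRingCat.ofHom σ) := by
    rw [Category.assoc, hsq, ← Category.assoc, Over.w t, SpreadingOutQbar.specOver_self_hom, Category.id_comp]
  refine ⟨AlgPoints.mk (pointOfClosedPoint S₀.hom _ ht) ?_, eq_specMap_comp_pointOfClosedPoint σ S₀.hom _ hP ht⟩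
  rw [pointOfClosedPoint_comp]
  simp only [Algebra.algebraMap_self, CommRingCat.ofHom_id, Spec.map_id]

/-- **(A3) The fibre over a point lying over a closed point is the base change of a rational fibre**: for
`f₀ : 𝒳₀ ⟶ S₀` over an algebraically closed `K` with `S₀` locally of finite type, `σ : K →+* L`, and an `L`-point `t`
of `S₀ ⊗_σ L` over a closed point of `S₀`, there is `w ∈ S₀(K)` under `t` with `(f₀ ⊗_σ L)⁻¹(t) ≅ (𝒳₀)_w ⊗_{K,σ} L`
over `L`: both are the fibre product of `f₀` with `Spec L → Spec K → S₀` (pasting the fibre square over `t` with the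
base-change square of `f₀`, resp. the base-change square of `(𝒳₀)_w` with the fibre square over `w` — the argument of
the tree's `QbarFibreAnchors.fiberOver_baseChangeHom_iso_of_over`, which assumes `w` given).
[cite: Hartshorne1977, Ch. II §3 Thm. 3.3 and p. 89 (fibre of a morphism)] -/
theorem exists_ratPoint_fibreIso_of_isClosed {K L : Type u} [Field K] [IsAlgClosed K] [Field L] (σ : K →+* L)
    {𝒳₀ S₀ : SchemeOver K} (f₀ : 𝒳₀ ⟶ S₀) [LocallyOfFiniteType S₀.hom] (t : AlgPoints ((baseChangeHom σ).obj S₀) L)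
    (ht : IsClosed ({(t.left ≫ baseChangeHomFst σ S₀) (closedPoint L)} : Set S₀.left)) :
    ∃ w : AlgPoints S₀ K, t.left ≫ baseChangeHomFst σ S₀ = Spec.map (CommRingCat.ofHom σ) ≫ w.left ∧
      Nonempty (fiberOver ((baseChangeHom σ).map f₀) t ≅ (baseChangeHom σ).obj (fiberOver f₀ w)) := by
  obtain ⟨w, hw⟩ := exists_ratPoint_over_of_isClosed σ S₀ t ht
  refine ⟨w, hw, ?_⟩
  -- the fibre of `f₀ ⊗_σ L` over `t` is cartesian over `f₀` along `Spec L → Spec K → S₀`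
  have HL : IsPullback
      (pullback.fst ((baseChangeHom σ).map f₀).left t.left ≫ baseChangeHomFst σ 𝒳₀)
      (fiberOver ((baseChangeHom σ).map f₀) t).hom f₀.left
      (Spec.map (CommRingCat.ofHom σ) ≫ w.left) := by
    rw [fiberOver_hom, SpreadingOutQbar.specOver_self_hom, Category.comp_id, ← hw]
    exact (IsPullback.of_hasPullback _ _).paste_horiz
      (SpreadingOutQbar.isPullback_baseChangeHom_map_left σ f₀)
  -- so is the base change of the rational fibre `(𝒳₀)_w`
  have hY : (fiberOver f₀ w).hom = pullback.snd f₀.left w.left := by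
    rw [fiberOver_hom, SpreadingOutQbar.specOver_self_hom, Category.comp_id]
  have sq : IsPullback (baseChangeHomFst σ (fiberOver f₀ w))
      ((baseChangeHom σ).obj (fiberOver f₀ w)).hom (pullback.snd f₀.left w.left)
      (Spec.map (CommRingCat.ofHom σ)) := by
    rw [← hY]
    exact IsPullback.of_hasPullback _ _
  have HR : IsPullback (baseChangeHomFst σ (fiberOver f₀ w) ≫ pullback.fst f₀.left w.left)
      ((baseChangeHom σ).obj (fiberOver f₀ w)).hom f₀.left
      (Spec.map (CommRingCat.ofHom σ) ≫ w.left) :=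
    sq.paste_horiz (IsPullback.of_hasPullback f₀.left w.left)
  exact ⟨Over.isoMk (HL.isoIsPullback _ _ HR) (HL.isoIsPullback_hom_snd _ _ HR)⟩

/-- **(A4) Isomorphic abelian varieties have the same dimension** (`dim` is the Krull dimension of the underlying
topological space, `Motives.schemeDim`, invariant under homeomorphisms — Mathlib `IsHomeomorph.topologicalKrullDim_eq`).
[folklore] -/
theorem dim_eq_of_iso_X {K : Type u} [Field K] {A B : AbelianVariety K} (e : A.X ≅ B.X) : A.dim = B.dim := by
  have h : topologicalKrullDim ↥A.X.left = topologicalKrullDim ↥B.X.left :=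
    IsHomeomorph.topologicalKrullDim_eq _ (Scheme.homeoOfIso ((Over.forget _).mapIso e)).isHomeomorph
  change schemeDim A.X.left = schemeDim B.X.left
  unfold schemeDim
  rw [h]

/-- **(A5) Models over an intermediate field, compatibly with base change.** For field maps
`τ : k →+* M` and `M → L` (an `M`-algebra structure on `L`), an abelian variety `A₁/k` has a model `A₀/M` with
`A₀ ⊗_M L ≅ A₁ ⊗_{k, (M → L) ∘ τ} L` over `L`: `A₀ := A₁ ⊗_τ M` (`AbelianVariety.baseChange`) and transitivity of
pull-back (Mathlib `Over.pullbackComp`). [cite: Hartshorne1977, Ch. II §3 (base extension)] [folklore] -/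
theorem exists_abelianVariety_over_intermediate {k M : Type u} [Field k] [Field M] (L : Type u) [Field L] [Algebra M L]
    (τ : k →+* M) (A₁ : AbelianVariety k) :
    ∃ A₀ : AbelianVariety M, Nonempty ((A₀.baseChange L).X ≅ (baseChangeHom ((algebraMap M L).comp τ)).obj A₁.X) := by
  letI : Algebra k M := τ.toAlgebra
  refine ⟨A₁.baseChange M, ⟨?_⟩⟩
  have hSpec : Spec.map (CommRingCat.ofHom ((algebraMap M L).comp τ)) =
      Spec.map (CommRingCat.ofHom (algebraMap M L)) ≫ Spec.map (CommRingCat.ofHom τ) := by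
    rw [CommRingCat.ofHom_comp, Spec.map_comp]
  have hX : ((A₁.baseChange M).baseChange L).X =
      (baseChangeHom (algebraMap M L)).obj ((baseChangeHom τ).obj A₁.X) := rfl
  exact eqToIso hX ≪≫ ((Over.pullbackComp (Spec.map (CommRingCat.ofHom (algebraMap M L)))
    (Spec.map (CommRingCat.ofHom τ))).app A₁.X).symm ≪≫ eqToIso (by
      change (Over.pullback _).obj A₁.X = (Over.pullback _).obj A₁.X
      rw [hSpec])

/-! ## §B The descent: R′ = `QbarFibreDescent` from Laurent–Schröer's para-abelian descent -/

/-- **R′ PROVED modulo one named print fact: `LaurentSchroer2023.groupLaw_of_isParaAbelian_of_point ℚ̄ →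
QbarFibreDescent`.** For `t` in the `ℚ̄`-locus and `A'.X ≅ 𝒳_t`: `t` lies over `w ∈ S₀(ℚ̄)` and
`𝒳_t ≅ P ⊗_σ ℂ` for the `ℚ̄`-fibre `P = (𝒳₀)_w` (§A); so `P` is PARA-ABELIAN for the field extension `σ : ℚ̄ → ℂ`
(`IsParaAbelian.of_iso`), hence — over the algebraically closed `ℚ̄` — the `ℚ̄`-scheme of an abelian variety `A₁`
(THE FACT through its Literature corollary `exists_abelianVariety_of_isParaAbelian`, [LaurentSchroer2023, §4 and
Prop. 4.3]); with `σ' : ℚ̄ →+* ℚ^al` the corestriction of `σ` (its values are algebraic over `ℚ`),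
`A₀ := A₁ ⊗_{σ'} ℚ^al` (A5) has `A₀ ⊗ ℂ ≅ A₁ ⊗_σ ℂ = P ⊗_σ ℂ ≅ 𝒳_t` (transitivity of base change [GortzWedhorn2020,
§(4.8) Def. 4.25 and the remark following it ("transitivity of fibre products")], Mathlib `Over.pullbackComp`) and
`dim A₀ = dim (A₀ ⊗ ℂ) = dim A'` (`AbelianVariety.dim_baseChange`, (A4)). Since 2026-08-21 the hypothesis is a
Literature THEOREM (`LaurentSchroer2023.groupLaw_of_isParaAbelian_of_point_holds (AlgebraicClosure ℚ)`, p299204),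
whence R′ outright: `qbarFibreDescent_holds` (part XVI-e, ring2-b01) = this theorem applied to it (REVISION 3).
[cite: LaurentSchroer2023, §4 (definition) and Prop. 4.3 (case S = Spec k)]
[cite: Hartshorne1977, Ch. II Ex. 3.14 and §3 Thm. 3.3] [cite: GortzWedhorn2020, §(4.8) Def. 4.25] -/
theorem qbarFibreDescent_of_paraAbelianDescent (hLS : LaurentSchroer2023.groupLaw_of_isParaAbelian_of_point (AlgebraicClosure ℚ)) :
    QbarFibreDescent := by
  intro σ 𝒳₀ S₀ f₀ h𝒳₀ hS₀ t ht A' hA'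
  obtain ⟨e⟩ := hA'
  haveI : LocallyOfFiniteType S₀.hom := locallyOfFiniteType_of_isQuasiProjectiveOver hS₀
  haveI : LocallyOfFiniteType 𝒳₀.hom := locallyOfFiniteType_of_isQuasiProjectiveOver h𝒳₀
  -- `t` lies over a `ℚ̄`-point `w`, and `𝒳_t ≅ P ⊗_σ ℂ` for the `ℚ̄`-fibre `P = (𝒳₀)_w` (§A)
  obtain ⟨w, -, ⟨e'⟩⟩ := exists_ratPoint_fibreIso_of_isClosed σ f₀ t ht
  -- THE FACT: `P` is para-abelian (`A'.X ≅ P ⊗_σ ℂ`), hence — `ℚ̄` being algebraically closed, so that `P` has a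
  -- rational point — the `ℚ̄`-scheme of an abelian variety `A₁` (the Literature corollary of Prop. 4.3)
  letI : Algebra (AlgebraicClosure ℚ) ℂ := σ.toAlgebra
  obtain ⟨A₁, hA₁⟩ := LaurentSchroer2023.exists_abelianVariety_of_isParaAbelian hLS
    (LaurentSchroer2023.IsParaAbelian.of_iso (L := ℂ) A' (e ≪≫ e'))
  -- `σ` takes algebraic values: it co-restricts to `σ' : ℚ̄ →+* ℚ^al ⊂ ℂ`; transport `A₁` along `σ'` (A5)
  have hmem : ∀ a : AlgebraicClosure ℚ, σ a ∈ IntermediateField.toSubfield (algebraicClosure ℚ ℂ) :=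
    fun a ↦ by
      rw [IntermediateField.mem_toSubfield, mem_algebraicClosure_iff]
      exact (Algebra.IsAlgebraic.isAlgebraic a).algHom σ.toRatAlgHom
  obtain ⟨A₀, ⟨e₀⟩⟩ := exists_abelianVariety_over_intermediate ℂ (σ.codRestrict _ hmem) A₁
  have hσ : (algebraMap (IntermediateField.toSubfield (algebraicClosure ℚ ℂ)) ℂ).comp (σ.codRestrict _ hmem) = σ :=
    RingHom.ext fun _ ↦ rfl
  -- the chart `A₀ ⊗ ℂ ≅ A₁ ⊗_σ ℂ = P ⊗_σ ℂ ≅ 𝒳_t`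
  have E : (A₀.baseChange ℂ).X ≅ fiberOver ((baseChangeHom σ).map f₀) t :=
    e₀ ≪≫ eqToIso (by rw [hσ, hA₁]) ≪≫ e'.symm
  refine ⟨A₀, ?_, ⟨E⟩⟩
  -- dimensions: `dim A₀ = dim (A₀ ⊗ ℂ) = dim A'` (A4)
  rw [← A₀.dim_baseChange ℂ]
  exact dim_eq_of_iso_X (E ≪≫ e.symm)

/-! ## §C `hE` from five named print facts; the headline rows of XVI-b/XVI-c re-based
(FOUR named print facts since 2026-08-21: `hLS` is a Literature theorem over `ℚ̄`; the `hLS`-free forms of these rows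
are part XVI-e's `…_of_fourPrintFacts` — REVISION 3 in the module docstring) -/

/-- **`hE = QbarHodgeFamilies` from FIVE named print facts**: Voisin's `ℚ̄`-spread of an absolute Hodge class
(`hVo`), Deligne's partie fixe (`hD`), "Hodge classes on abelian varieties are absolute" (`hDel`), Catanese's abelian
fibres (`hCat`), Laurent–Schröer's para-abelian descent (`hLS`) — XVI-c's `qbarHodgeFamilies_of_flatSpread_of_
qbarFibreDescent` with its residual `hDesc` PROVED (§B). No `@[conjecture]` hypothesis. (Since 2026-08-21 `hLS` is
itself a Literature theorem; XVI-e's `qbarHodgeFamilies_of_fourPrintFacts` is this row with `hLS` discharged.)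
[cite: Voisin2007HodgeLoci, §3 proof of Prop. 1.2, first paragraph (arXiv math/0605766 p. 6)]
[cite: Catanese2002DeformationTypes, §4 Thm. 4.1 and Thm. 4.6] [cite: LaurentSchroer2023, §4 Prop. 4.3] -/
theorem qbarHodgeFamilies_of_printFacts (hVo : voisin2007_flatSpread_of_isAbsoluteHodgeClass)
    (hD : deligne_globalInvariantCycles) (hDel : deligne1982_hodgeClasses_abelianVariety_absoluteHodge)
    (hCat : catanese2002_abelianFibres_of_abelianFibre)
    (hLS : LaurentSchroer2023.groupLaw_of_isParaAbelian_of_point (AlgebraicClosure ℚ)) : QbarHodgeFamilies :=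
  qbarHodgeFamilies_of_flatSpread_of_qbarFibreDescent hVo hD hDel hCat (qbarFibreDescent_of_paraAbelianDescent hLS)

/-- The same from the WEAKLY absolute spread (the form held by the bridge `QbarSummit`). [cite: Voisin2007HodgeLoci, Def. 2.1 and §3] -/
theorem qbarHodgeFamilies_of_weaklyAbsoluteFlatSpread_of_printFacts
    (hWS : voisin2007_flatSpread_of_isWeaklyAbsoluteHodgeClass) (hD : deligne_globalInvariantCycles)
    (hDel : deligne1982_hodgeClasses_abelianVariety_absoluteHodge) (hCat : catanese2002_abelianFibres_of_abelianFibre)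
    (hLS : LaurentSchroer2023.groupLaw_of_isParaAbelian_of_point (AlgebraicClosure ℚ)) : QbarHodgeFamilies :=
  qbarHodgeFamilies_of_printFacts (flatSpread_of_isAbsoluteHodgeClass_of_isWeaklyAbsolute hWS) hD hDel hCat hLS

/-- **EXACTNESS of row Q modulo named print facts only**: `HC_AV ↔ HC_QbarAV ∧ Q` — the forward direction is
`HC_AV ⟹ HC_QbarAV` (part XIV) and `HC_AV ⟹ Q` (part XVI §C); the backward one is part XVI's KIND-2 reading with
`hE` from the five facts. Both `HC_QbarAV` and `Q = QbarSpreading` are OPEN; neither is a case of HC in print.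
[cite: Voisin2007HodgeLoci, §3 proof of Prop. 1.2 (p. 6)] [cite: Catanese2002DeformationTypes, §4 Thm. 4.1 and Thm. 4.6]
[cite: LaurentSchroer2023, §4 Prop. 4.3] -/
theorem HC_AV_iff_hodgeConjectureQbarAV_and_qbarSpreading_of_printFacts
    (hVo : voisin2007_flatSpread_of_isAbsoluteHodgeClass) (hD : deligne_globalInvariantCycles)
    (hDel : deligne1982_hodgeClasses_abelianVariety_absoluteHodge) (hCat : catanese2002_abelianFibres_of_abelianFibre)
    (hLS : LaurentSchroer2023.groupLaw_of_isParaAbelian_of_point (AlgebraicClosure ℚ)) :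
    HodgeAbelianVarieties ↔ HodgeConjectureQbarAV ∧ QbarSpreading :=
  HC_AV_iff_hodgeConjectureQbarAV_and_qbarSpreading (qbarHodgeFamilies_of_printFacts hVo hD hDel hCat hLS)

/-- **EXACTNESS on the arithmetic axis modulo named print facts only**: `HC_AV ↔ HC_CM ∧ L(𝔇) ∧ Q` modulo [`hJ` =
Milne 1999 Thm 7.1 + Deligne 1982 2.9(b); five named facts]. `HC_CM` is a hypothesis BY NAME and load-bearing.
[cite: Milne1999, §7 Thm. 7.1] [cite: LaurentSchroer2023, §4 Prop. 4.3] -/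
theorem HC_AV_iff_HC_CM_and_spanLifting_and_qbarSpreading_of_printFacts (𝔇 : RealizationFamily)
    (hJ : CMAbelianHodge → SpecialisationsAlgebraicAV 𝔇) (hVo : voisin2007_flatSpread_of_isAbsoluteHodgeClass)
    (hD : deligne_globalInvariantCycles) (hDel : deligne1982_hodgeClasses_abelianVariety_absoluteHodge)
    (hCat : catanese2002_abelianFibres_of_abelianFibre)
    (hLS : LaurentSchroer2023.groupLaw_of_isParaAbelian_of_point (AlgebraicClosure ℚ)) :
    HodgeAbelianVarieties ↔ CMAbelianHodge ∧ (SpanLiftingAtAlmostAllPrimesAV 𝔇 ∧ QbarSpreading) :=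
  HC_AV_iff_HC_CM_and_spanLifting_and_qbarSpreading 𝔇 hJ (qbarHodgeFamilies_of_printFacts hVo hD hDel hCat hLS)

/-- **THE ITEM EXACTLY, modulo named print facts only**: `CMToAbelian ↔ ModCM (L(𝔇) ∧ Q)` —
stmt-HodgeConjecture-16267 — modulo [`hJ`; Voisin's spread, the partie fixe, Deligne 2.11, Catanese's abelian fibres,
Laurent–Schröer's para-abelian descent — named print facts]. The item stays OPEN (`L(𝔇)` and `Q` are open).
[cite: Milne1999, §7 Thm. 7.1] [cite: Voisin2007HodgeLoci, §3 (p. 6)] [cite: LaurentSchroer2023, §4 Prop. 4.3] -/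
theorem cmToAbelian_iff_modCM_spanLifting_and_qbarSpreading_of_printFacts (𝔇 : RealizationFamily)
    (hJ : CMAbelianHodge → SpecialisationsAlgebraicAV 𝔇) (hVo : voisin2007_flatSpread_of_isAbsoluteHodgeClass)
    (hD : deligne_globalInvariantCycles) (hDel : deligne1982_hodgeClasses_abelianVariety_absoluteHodge)
    (hCat : catanese2002_abelianFibres_of_abelianFibre)
    (hLS : LaurentSchroer2023.groupLaw_of_isParaAbelian_of_point (AlgebraicClosure ℚ)) :
    CMToAbelian ↔ ModCM (SpanLiftingAtAlmostAllPrimesAV 𝔇 ∧ QbarSpreading) :=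
  cmToAbelian_iff_modCM_spanLifting_and_qbarSpreading 𝔇 hJ (qbarHodgeFamilies_of_printFacts hVo hD hDel hCat hLS)

end Summit.HodgeConjecture.HodgeConjecture.Ring2.Deform
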